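import Literature.NumberTheory.GaloisRepresentations.HomDualReadoutLocal
import Literature.NumberTheory.GaloisRepresentations.GaloisRepUnramifiedProofs
import Literature.NumberTheory.GaloisRepresentations.LocalFieldInertiaCdOne
import Literature.NumberTheory.Automorphic.AdicCompletionLocalField
import HarnessLib

/-!
# The `(R2)` readout compatibility over an ARBITRARY extension field, and the inertia bridge

Topic `NumberTheory/GaloisRepresentations`; namespace `Literature.NumberTheory.GaloisRepresentations.HomDual`.
Definitions with bodies and theorems; no named fact, no instance, no `sorry`.  Sequel to `HomDualReadoutLocal`
(which treated the completions `K_v` at FINITE places); here the extension field `L/K` is arbitrary of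
characteristic `0`, so that the archimedean completions (and every `Place.Completion v`, through
`galoisCohomology.localization = galoisCohomology.res`) are covered by ONE statement.

* §1 `tateDualRestrictIso K L ρ n : ρ^∨(1)|_{Γ_L} ≅ Hom(M|_{Γ_L}, μₙ(L̄))` (post-composition with the bijection
  `muTransfer : μₙ(K̄) → μₙ(L̄)`; the tree's `tateDualLocalIso` is the case `L = K_v`), and
  `tateDualRestrictUnitsIso K L ρ n : ρ^∨(1)|_{Γ_L} ≅ Hom_ℤ(M|_{Γ_L}, L̄ˣ)` for `n`-torsion `M`.
* §2 **`res_dualδ₀_eq`**: `res_{L/K} ((tateDualUnitsIso)⁻¹ (δ₀_K h)) = (tateDualRestrictUnitsIso)⁻¹ (δ₀_L (ι_L ∘ h))`,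
  and its reading at an arbitrary place `v` of a number field (`localization_dualδ₀_eq_place`).
* §3 **the inertia bridge** `galUnr_le_stabilizer_of_isUnramifiedAt`: if `ρ` is unramified at a finite place `v`
  and `ker ρ` acts trivially on a `Γ_K`-set `β`, the local inertia group `I_{K_v} = galUnr K_v` fixes `β`
  pointwise through `res_v` — the hypothesis `hstab` of `exists_unitValued_of_unramified` for the basis of an
  unramified presentation.

References: Milne, *Arithmetic Duality Theorems* I §0, §2, §4; Neukirch–Schmidt–Wingberg (1.5.2);
Serre, *Local Fields* IV §4; Neukirch, *Algebraic Number Theory* II (9.6).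
-/

noncomputable section

namespace Literature.NumberTheory.GaloisRepresentations

namespace HomDual

open Function ContRepresentation Field Literature.Algebra.Homology Literature.Algebra.Homology.DiscreteRep
  DiscreteGaloisModule

/-! ## §1 `ρ^∨(1)|_{Γ_L} ≅ Hom(M|_{Γ_L}, μₙ(L̄)) ≅ Hom_ℤ(M|_{Γ_L}, L̄ˣ)` -/

section RestrictIso

variable (K : Type) [Field K] (L : Type) [Field L] [Algebra K L]
variable {M : Type} [AddCommGroup M] [TopologicalSpace M] [DiscreteTopology M] [Finite M]

/-- `f ↦ muTransfer ∘ f : Hom(M, μₙ(K̄)) → Hom(M, μₙ(L̄))`. [cite: MilneADT2006, I §0, I §2] -/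
def tateDualTransferL (n : ℕ) (f : TateDual K M n) : HomCarrier M (MuCarrier L n) :=
  HomCarrier.ofAddMonoidHom ((muTransfer K L n).comp
    { toFun := fun m => (f m : MuCarrier K n)
      map_zero' := map_zero f
      map_add' := map_add f })

omit [TopologicalSpace M] [DiscreteTopology M] [Finite M] in
/-- Unfolding `tateDualTransferL`. [cite: MilneADT2006, I §0] -/
@[simp] theorem tateDualTransferL_apply (n : ℕ) (f : TateDual K M n) (m : M) :
    tateDualTransferL K L n f m = muTransfer K L n (f m) := rfl

variable [CharZero K] [CharZero L]

omit [TopologicalSpace M] [DiscreteTopology M] [Finite M] in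
/-- `Hom(M, μₙ(K̄)) ≃ Hom(M, μₙ(L̄))` (`muTransfer` is bijective in characteristic `0`). [cite: MilneADT2006, I §0, I §2] -/
def tateDualTransferLEquiv (n : ℕ) [NeZero n] : TateDual K M n ≃+ HomCarrier M (MuCarrier L n) where
  toFun := tateDualTransferL K L n
  invFun g :=
    { toFun := fun m => (muTransferEquiv K L n).symm (g m)
      map_zero' := by simp only [map_zero]; rfl
      map_add' := fun m m' => by simp only [map_add]; rfl }
  left_inv f := by
    refine DFunLike.ext _ _ fun m => ?_
    exact (muTransferEquiv K L n).symm_apply_apply (f m)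
  right_inv g := HomCarrier.ext fun m => by
    rw [tateDualTransferL_apply]
    exact (muTransferEquiv K L n).apply_symm_apply (g m)
  map_add' f f' := HomCarrier.ext fun m => by
    rw [HomCarrier.add_apply, tateDualTransferL_apply, tateDualTransferL_apply, tateDualTransferL_apply, ← map_add]
    rfl

/-- **`ρ^∨(1)|_{Γ_L} ≅ Hom(M|_{Γ_L}, μₙ(L̄))`** as topological `Γ_L`-representations (the tree's
`tateDualLocalIso` for `L = K_v`). [cite: MilneADT2006, I §0, I §2] -/
def tateDualRestrictIso (ρ : DiscreteGaloisModule K M) (n : ℕ) [NeZero n] :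
    ((ρ.tateDual n).restrict (absGaloisRestrict K L)).toTopRep ≅
      ((ρ.restrict (absGaloisRestrict K L)).homRep (mu L n)).toTopRep :=
  topRepIsoOfEquiv (X := ((ρ.tateDual n).restrict (absGaloisRestrict K L)).toTopRep)
    (Y := ((ρ.restrict (absGaloisRestrict K L)).homRep (mu L n)).toTopRep)
    { (tateDualTransferLEquiv K L n (M := M)).toIntLinearEquiv with
      continuous_toFun := continuous_of_discreteTopology
      continuous_invFun := continuous_of_discreteTopology }
    fun σ f => HomCarrier.ext fun m => by
      change tateDualTransferL K L n ((ρ.tateDual n) (absGaloisRestrict K L σ) f) m =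
        (((ρ.restrict (absGaloisRestrict K L)).homRep (mu L n)) σ (tateDualTransferL K L n f)) m
      rw [tateDualTransferL_apply, ContinuousRep.homRep_apply_apply_apply, tateDualTransferL_apply,
        ContinuousRep.restrict_apply, map_inv, ← muTransfer_mu]
      rfl

/-- **`ρ^∨(1)|_{Γ_L} ≅ Hom_ℤ(M|_{Γ_L}, L̄ˣ)`** for `n`-torsion `M` (`tateDualRestrictIso ≪≫ homMuUnitsIso`).
[cite: MilneADT2006, I §0, I §2] -/
def tateDualRestrictUnitsIso (ρ : DiscreteGaloisModule K M) (n : ℕ) [NeZero n] (hM : ∀ m : M, n • m = 0) :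
    ((ρ.tateDual n).restrict (absGaloisRestrict K L)).toTopRep ≅
      (homGaloisModule (ρ.restrict (absGaloisRestrict K L)) (units L)).toTopRep :=
  tateDualRestrictIso K L ρ n ≪≫ homMuUnitsIso L n (ρ.restrict (absGaloisRestrict K L)) hM

/-- Unfolding `tateDualRestrictUnitsIso`: `f ↦ (m ↦ ι_L (f m))`, through `unitsVal`. [cite: MilneADT2006, I §0, I §2] -/
theorem unitsVal_tateDualRestrictUnitsIso_hom_apply (ρ : DiscreteGaloisModule K M) (n : ℕ) [NeZero n]
    (hM : ∀ m : M, n • m = 0) (f : TateDual K M n) (m : M) :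
    unitsVal L ((show M →ₗ[ℤ] UnitsCarrier L from (tateDualRestrictUnitsIso K L ρ n hM).hom.hom f) m) =
      Units.map (absClosureEmbedding K L : AlgebraicClosure K →* AlgebraicClosure L) (muVal K n (f m)) := rfl

/-- `Hⁱ(L, ρ^∨(1)|_L) → Hⁱ(L, Hom_ℤ(M|_L, L̄ˣ))` is bijective. [cite: MilneADT2006, I §0, I §2] -/
theorem cohomologyMap_tateDualRestrictUnitsIso_bijective (ρ : DiscreteGaloisModule K M) (n : ℕ) [NeZero n]
    (hM : ∀ m : M, n • m = 0) (q : ℕ) :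
    Bijective (cohomologyMap (tateDualRestrictUnitsIso K L ρ n hM).hom q) :=
  (continuousCohomologyEquivOfIso (tateDualRestrictUnitsIso K L ρ n hM) q).bijective

/-- `Hⁱ(e.hom) (Hⁱ(e.inv) y) = y` for `e = tateDualRestrictUnitsIso`. [cite: MilneADT2006, I §0, I §2] -/
theorem cohomologyMap_tateDualRestrictUnitsIso_hom_inv_apply (ρ : DiscreteGaloisModule K M) (n : ℕ) [NeZero n]
    (hM : ∀ m : M, n • m = 0) (q : ℕ)
    (y : continuousCohomology q (homGaloisModule (ρ.restrict (absGaloisRestrict K L)) (units L)).toTopRep) :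
    cohomologyMap (tateDualRestrictUnitsIso K L ρ n hM).hom q
      (cohomologyMap (tateDualRestrictUnitsIso K L ρ n hM).inv q y) = y :=
  cohomologyMap_inv_hom_apply (tateDualRestrictUnitsIso K L ρ n hM).symm q y

end RestrictIso

/-! ## §2 `(R2)` over an arbitrary extension field -/

section R2

variable {K : Type} [Field K] [CharZero K] (L : Type) [Field L] [Algebra K L] [CharZero L]
variable {X Y M : Type}
  [AddCommGroup X] [TopologicalSpace X] [DiscreteTopology X] [Module.Finite ℤ X]
  [AddCommGroup Y] [TopologicalSpace Y] [DiscreteTopology Y] [Module.Finite ℤ Y]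
  [AddCommGroup M] [TopologicalSpace M] [DiscreteTopology M] [Finite M]
variable (ρX : DiscreteGaloisModule K X) (ρY : DiscreteGaloisModule K Y) (ρ : DiscreteGaloisModule K M)
  (i : ρX.toContRepresentation →ⁱL ρY.toContRepresentation)
  (p : ρY.toContRepresentation →ⁱL ρ.toContRepresentation)

/-- Module-level compatibility: post-composition with `ι_L` corresponds, under `tateDualUnitsIso` and
`tateDualRestrictUnitsIso`, to the identity of `ρ^∨(1)`. [cite: MilneADT2006, I §0, I §2] -/
theorem postcompAddHom_unitsTransfer_eq_restrict (n : ℕ) [NeZero n] (hM : ∀ m : M, n • m = 0)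
    (F : DiscreteRep.HomCarrier M (UnitsCarrier K)) :
    postcompAddHom (units K) (units L) (unitsTransfer K L) F =
      (tateDualRestrictUnitsIso K L ρ n hM).hom.hom ((tateDualUnitsIso K ρ n hM).inv.hom F) := by
  set f := (tateDualUnitsIso K ρ n hM).inv.hom F with hf
  have hF : F = (tateDualUnitsIso K ρ n hM).hom.hom f := by
    rw [hf, ← TopRep.comp_apply, (tateDualUnitsIso K ρ n hM).inv_hom_id, TopRep.id_apply]
  rw [hF]
  refine LinearMap.ext fun m => unitsVal_injective L ?_
  rw [unitsVal_tateDualRestrictUnitsIso_hom_apply]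
  change unitsVal L (unitsTransferAddHom K L
    ((show M →ₗ[ℤ] UnitsCarrier K from (tateDualUnitsIso K ρ n hM).hom.hom f) m)) = _
  rw [unitsVal_unitsTransferAddHom, tateDualUnitsIso_hom_apply, unitsVal_kummerInclAddHom]

/-- **`(R2)` over an arbitrary extension field `L/K`**: for a presentation `0 → X → Y → M → 0` of a finite
`n`-torsion Galois module over `K`, an equivariant `h : X → K̄ˣ` and a field `L ⊇ K` of characteristic `0`,
`res_{L/K} ((tateDualUnitsIso)⁻¹ (δ₀_K h)) = (tateDualRestrictUnitsIso_L)⁻¹ (δ₀_L (ι_L ∘ h))` in `H¹(L, ρ^∨(1))`.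
[cite: MilneADT2006, I §0, I §2, I §4] [cite: NeukirchSchmidtWingberg2008, (1.3.3), (1.5.2)] -/
theorem res_dualδ₀_eq (n : ℕ) [NeZero n] (hM : ∀ m : M, n • m = 0)
    (hS : IsSES (toTopRepHom ρX ρY i) (toTopRepHom ρY ρ p))
    (h : (homGaloisModule ρX (units K)).toTopRep.ρ.invariants) :
    galoisCohomology.res (ρ.tateDual n) L 1
        (cohomologyMap (tateDualUnitsIso K ρ n hM).inv 1
          (dualδ₀ ρX ρY ρ (units K) i p hS (baer_unitsCarrier K) h)) =
      cohomologyMap (tateDualRestrictUnitsIso K L ρ n hM).inv 1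
        (dualδ₀ (ρX.restrictField L) (ρY.restrictField L) (ρ.restrictField L) (units L)
          (restrictIntertwining ρX ρY i) (restrictIntertwining ρY ρ p) (isSES_restrict ρX ρY ρ hS)
          (baer_unitsCarrier L)
          (transferInvariant ρX (units K) (units L) (unitsTransfer K L) h)) := by
  apply (cohomologyMap_tateDualRestrictUnitsIso_bijective K L ρ n hM 1).1
  rw [cohomologyMap_tateDualRestrictUnitsIso_hom_inv_apply,
    ← map_dualδ₀_eq ρX ρY ρ (units K) (units L) (unitsTransfer K L) i p hS
      (baer_unitsCarrier K) (baer_unitsCarrier L) h]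
  set δ := dualδ₀ ρX ρY ρ (units K) i p hS (baer_unitsCarrier K) h
  let θ : absoluteGaloisGroup L →ₜ* absoluteGaloisGroup K := absGaloisRestrict K L
  have h1 : galoisCohomology.res (ρ.tateDual n) L 1 (cohomologyMap (tateDualUnitsIso K ρ n hM).inv 1 δ) =
      ContinuousCohomology.map θ (resAlongHom θ (tateDualUnitsIso K ρ n hM).inv) 1 δ :=
    (map_resAlongHom_eq θ (tateDualUnitsIso K ρ n hM).inv 1 δ).symm
  rw [h1]
  exact (map_comp_apply_of θ (ContinuousMonoidHom.id _) θ (fun _ => rfl)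
    (resAlongHom θ (tateDualUnitsIso K ρ n hM).inv) (resIdHom (tateDualRestrictUnitsIso K L ρ n hM).hom)
    (postcompResHom ρ (units K) (units L) (unitsTransfer K L))
    (fun F => postcompAddHom_unitsTransfer_eq_restrict L ρ n hM F) 1 δ).symm

end R2

/-! ## §2b At an arbitrary place of a number field -/

section Place

open NumberField IsDedekindDomain

variable {K : Type} [Field K] [NumberField K]

omit [NumberField K] in
/-- Completions of a number field have characteristic `0` (an instance-free statement; supply it with `haveI`).
[cite: MilneADT2006, I §4] -/
theorem charZero_of_algebra (L : Type) [Field L] [Algebra K L] [CharZero K] : CharZero L :=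
  charZero_of_injective_algebraMap (algebraMap K L).injective

variable {X Y M : Type}
  [AddCommGroup X] [TopologicalSpace X] [DiscreteTopology X] [Module.Finite ℤ X]
  [AddCommGroup Y] [TopologicalSpace Y] [DiscreteTopology Y] [Module.Finite ℤ Y]
  [AddCommGroup M] [TopologicalSpace M] [DiscreteTopology M] [Finite M]
variable (ρX : DiscreteGaloisModule K X) (ρY : DiscreteGaloisModule K Y) (ρ : DiscreteGaloisModule K M)
  (i : ρX.toContRepresentation →ⁱL ρY.toContRepresentation)
  (p : ρY.toContRepresentation →ⁱL ρ.toContRepresentation)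

/-- **`(R2)` at every place `v` (finite or infinite)**: `loc_v ((tateDualUnitsIso)⁻¹ (δ₀_K h))` is the class read
off over `K_v` from `ι_v ∘ h` (`res_dualδ₀_eq` with `L = K_v`; the instance `[CharZero K_v]` is
`charZero_of_algebra (Place.Completion v)`). [cite: MilneADT2006, I §0, I §2, I §4] -/
theorem localization_dualδ₀_eq_place (v : Place K) [CharZero (Place.Completion v)] (n : ℕ) [NeZero n]
    (hM : ∀ m : M, n • m = 0) (hS : IsSES (toTopRepHom ρX ρY i) (toTopRepHom ρY ρ p))
    (h : (homGaloisModule ρX (units K)).toTopRep.ρ.invariants) :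
    galoisCohomology.localization (ρ.tateDual n) v 1
        (cohomologyMap (tateDualUnitsIso K ρ n hM).inv 1
          (dualδ₀ ρX ρY ρ (units K) i p hS (baer_unitsCarrier K) h)) =
      cohomologyMap (tateDualRestrictUnitsIso K (Place.Completion v) ρ n hM).inv 1
        (dualδ₀ (ρX.restrictField (Place.Completion v)) (ρY.restrictField (Place.Completion v))
          (ρ.restrictField (Place.Completion v)) (units (Place.Completion v))
          (restrictIntertwining ρX ρY i) (restrictIntertwining ρY ρ p) (isSES_restrict ρX ρY ρ hS)
          (baer_unitsCarrier (Place.Completion v))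
          (transferInvariant ρX (units K) (units (Place.Completion v)) (unitsTransfer K (Place.Completion v)) h)) :=
  res_dualδ₀_eq (Place.Completion v) ρX ρY ρ i p n hM hS h

end Place

/-! ## §3 The inertia bridge: unramified `ρ` ⟹ local inertia fixes the index set of the presentation -/

section Inertia

open NumberField IsDedekindDomain IsNonarchimedeanLocalField

variable {K : Type} [Field K] [NumberField K] (v : HeightOneSpectrum (𝓞 K))
variable {M : Type} [AddCommGroup M] [TopologicalSpace M] [DiscreteTopology M]

/-- **The inertia bridge.**  If `ρ` is unramified at the finite place `v` (`GaloisRep.IsUnramifiedAt`, inertia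
groups of the primes of `\bar ℤ_K` above `v`) and its kernel acts trivially on a `Γ_K`-set `β`, then the local
inertia group `I_{K_v} = galUnr K_v ≤ Γ_{K_v}` fixes `β` pointwise through `res_v : Γ_{K_v} → Γ_K`
(`isUnramifiedAt_iff_toLocal_holds`: `res_v (I_{K_v})` lies in an inertia group above `v`).  This is the
hypothesis `hstab` of `exists_unitValued_of_unramified` for the permuted basis of an unramified presentation.
[cite: NeukirchANT1999, Ch. II (9.6)] [cite: SerreLocalFields1979, IV §4] -/
theorem galUnr_le_stabilizer_of_isUnramifiedAt (ρ : DiscreteGaloisModule K M) (hur : GaloisRep.IsUnramifiedAt v ρ)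
    {β : Type} [MulAction (absoluteGaloisGroup K) β]
    (hβ : ∀ (γ : absoluteGaloisGroup K) (b : β), ρ γ = 1 → γ • b = b) (b : β) :
    letI := resAction K (v.adicCompletion K) β
    galUnr (v.adicCompletion K) ≤ MulAction.stabilizer (absoluteGaloisGroup (v.adicCompletion K)) b := by
  letI := resAction K (v.adicCompletion K) β
  intro σ hσ
  rw [galUnr_eq_absInertia] at hσ
  have h := (GaloisRep.isUnramifiedAt_iff_toLocal_holds v ρ).1 hur σ hσ
  rw [MulAction.mem_stabilizer_iff, resAction_smul]
  exact hβ _ b h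

end Inertia

end HomDual

end Literature.NumberTheory.GaloisRepresentations

end
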